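import Mathlib
import HarnessLib
import Summits.HubbardSuperconductivity.HubbardSuperconductivity.Theorems.KLProgrammeKLRegimeSplitModelCongr
import Summits.HubbardSuperconductivity.HubbardSuperconductivity.Theorems.KLProgrammeKLRegimeSplitDegenerateFrameClass

/-!
# Route `KLProgramme` — ENGINE item stmt-HubbardSuperconductivity-20437 `KLRegimeEngineV17F2`: ON THE DEGENERATE FRAME CLASS (`R.Gfr 0 = 0`) THE
# MODEL CARRIERS AT THE FLOW FRAME ARE THE ZERO-FRAME CARRIERS (cell gate-hubbard-kl, registrant seat gate-hubbard-kl-p1b g18; pen (R422)(B)(2) /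
# (R423)(D) / (R426)(B), cure (γ′) of «(C)-HRES-GFR0-VACUITY»)

WHAT.  `…KLRegimeSplitDegenerateFrameClass` (p715405) shows that on the degenerate class the rows' own binders force `evalM K_m ≡ 0` (`m ≤ n`); p2 g6's MODEL
CONGRUENCE (`…KLRegimeSplitModelCongr`: `klEffectiveAction_congr`, `klLocSelfEnergyRe_congr`, `klFieldStrength_congr`, `klPairAmplitude_congr`, `klShell_congr`, …) says the
model reads a frame only through its LATTICE values, and the reading point `klFermiPoint μ K θ` reads `K.eval` on the continuum.  Composing the two (nothing is
re-derived; the congruence chain is CITED):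
* `eval_eq_zero_eval_of_evalM_eq_zero` — `evalM K ≡ 0 ⇒ ∀ p, K.eval p = (0 : TrigPolyC4v).eval p` (so both the lattice and the continuum hypotheses of the congruences hold);
* `klFermiPoint_congr_eval`, `klLocalPart_congr_eval` — the reading point and the cumulative reading `ν_n(K)` under equality of ALL values (the continuum is needed for the
  reading point; `klLocSelfEnergyRe_congr` supplies the lattice half);
* the zero-frame identities `klEffectiveAction_eq_zeroFrame_of_evalM`, `klLocalPart_eq_zeroFrame_of_evalM`, `klFieldStrength_eq_zeroFrame_of_evalM`,
  `klPairAmplitude_eq_zeroFrame_of_evalM`, `klShell_eq_zeroFrame_of_evalM`;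
* **`klLocalPart_klFlowFrameU_eq_zeroFrame_of_histP_gfr_zero`** / `klFlowAction_eq_zeroFrame_of_histP_gfr_zero` / `klLocalPart_klFlowFrameU_eq_zeroFrame_of_frameOK_gfr_zero`:
  under `R.Gfr 0 = 0` and the history (resp. the `FrameOK` binder), the scale-`m` reading / action at the flow frame IS the one at the zero frame — the degenerate branch of a
  row is literally its zero-frame member.
Bookkeeping only; nothing here asserts any row of 20437, the cure, «TADPOLE-NONVANISHING», K3, the Kohn–Luttinger margin or superconductivity.  0 kit · 0 lit.
References: FST 1996 §1 (`e = E − K`) [cite: FeldmanSalmhoferTrubowitz1996]; BGM 2006 §2.4 [cite: BenfattoGiulianiMastropietro2006].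
-/

noncomputable section

namespace Summit.HubbardSuperconductivity.HubbardSuperconductivity.Theorems.KLRegimeSplit

set_option linter.dupNamespace false -- summit = problem name (single-conjunct summit), D-0017

open Real Finset Literature.MathematicalPhysics.QuantumLattice Literature.Probability.LatticeModels
open Summit.HubbardSuperconductivity.HubbardSuperconductivity.Theorems.KLProgrammeLegKernels
open Summit.HubbardSuperconductivity.HubbardSuperconductivity.Theorems.DispersionFlow
open Summit.HubbardSuperconductivity.HubbardSuperconductivity.Theorems.PerturbedFermiCurve

variable {K K' : TrigPolyC4v}

/-! ## §1 Vanishing on `Momentum` ⇒ the values of the zero frame -/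

/-- A frame that vanishes on `Momentum` has the values of the zero frame everywhere. -/
theorem eval_eq_zero_eval_of_evalM_eq_zero (h0 : ∀ q : Momentum, evalM K q = 0) : ∀ p, K.eval p = (0 : TrigPolyC4v).eval p := by
  intro p
  rw [TrigPolyC4v.eval_zero]
  simpa [evalM] using h0 (WithLp.toLp 2 p)

/-- In particular at the lattice momenta (the hypothesis of `…ModelCongr`). -/
theorem eval_latticeMomentum_eq_zero_eval_of_evalM_eq_zero (L : ℕ) (h0 : ∀ q : Momentum, evalM K q = 0) :
    ∀ k : TorusSite 2 L, K.eval (latticeMomentum L k) = (0 : TrigPolyC4v).eval (latticeMomentum L k) :=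
  fun k => eval_eq_zero_eval_of_evalM_eq_zero h0 (latticeMomentum L k)

/-! ## §2 The reading point and the cumulative reading under equality of all values -/

/-- The frame's Fermi point depends on the frame only through its values on the continuum. -/
theorem klFermiPoint_congr_eval (μ : ℝ) (h : ∀ p, K.eval p = K'.eval p) : klFermiPoint μ K = klFermiPoint μ K' := by
  funext θ; simp only [klFermiPoint, h]

section Model

variable (L M : ℕ) [NeZero L] [NeZero M]

/-- **The cumulative reading `ν_n(K)` depends on the frame only through its values** (lattice values for the action — `klLocSelfEnergyRe_congr` — and
continuum values for the reading point). -/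
theorem klLocalPart_congr_eval (β U μ : ℝ) (h : ∀ p, K.eval p = K'.eval p) (n : ℕ) :
    klLocalPart L M β U μ K n = klLocalPart L M β U μ K' n := by
  funext θ
  rw [klLocalPart, klLocalPart, klFermiPoint_congr_eval μ h, klLocSelfEnergyRe_congr L M (fun k => h _) β U μ n]

/-! ## §3 Zero-frame identities for a frame with vanishing values -/

omit [NeZero M] in
/-- A frame with vanishing values carries the zero-frame effective action. -/
theorem klEffectiveAction_eq_zeroFrame_of_evalM (β U μ : ℝ) (h0 : ∀ q : Momentum, evalM K q = 0) (e₀ : ℝ) (n : ℕ) :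
    klEffectiveAction L M β U μ K e₀ n = klEffectiveAction L M β U μ 0 e₀ n :=
  klEffectiveAction_congr L M (eval_latticeMomentum_eq_zero_eval_of_evalM_eq_zero L h0) β U μ e₀ n

/-- A frame with vanishing values has the zero frame's reading `ν_n`. -/
theorem klLocalPart_eq_zeroFrame_of_evalM (β U μ : ℝ) (h0 : ∀ q : Momentum, evalM K q = 0) (n : ℕ) :
    klLocalPart L M β U μ K n = klLocalPart L M β U μ 0 n :=
  klLocalPart_congr_eval L M β U μ (eval_eq_zero_eval_of_evalM_eq_zero h0) n

/-- A frame with vanishing values has the zero frame's field strength. -/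
theorem klFieldStrength_eq_zeroFrame_of_evalM (β U μ : ℝ) (h0 : ∀ q : Momentum, evalM K q = 0) (n : ℕ) :
    klFieldStrength L M β U μ K n = klFieldStrength L M β U μ 0 n :=
  klFieldStrength_congr L M (eval_latticeMomentum_eq_zero_eval_of_evalM_eq_zero L h0) β U μ n

/-- A frame with vanishing values has the zero frame's pair amplitudes. -/
theorem klPairAmplitude_eq_zeroFrame_of_evalM (β U μ : ℝ) (h0 : ∀ q : Momentum, evalM K q = 0) (n : ℕ) :
    klPairAmplitude L M β U μ K n = klPairAmplitude L M β U μ 0 n :=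
  klPairAmplitude_congr L M (eval_latticeMomentum_eq_zero_eval_of_evalM_eq_zero L h0) β U μ n

omit [NeZero M] in
/-- A frame with vanishing values has the zero frame's shells. -/
theorem klShell_eq_zeroFrame_of_evalM (μ : ℝ) (h0 : ∀ q : Momentum, evalM K q = 0) (n : ℕ) :
    klShell L μ K n = klShell L μ 0 n :=
  klShell_congr L (eval_latticeMomentum_eq_zero_eval_of_evalM_eq_zero L h0) μ n

/-! ## §4 On the degenerate class the flow-frame carriers are the zero-frame carriers -/

/-- **On the degenerate class the reading at the flow frame IS the reading at the zero frame**: under `R.Gfr 0 = 0` and the history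
`HistP klPredsV17F2 … n`, `ν_m(K_m) = ν_m(0)` for every `m ≤ n`. -/
theorem klLocalPart_klFlowFrameU_eq_zeroFrame_of_histP_gfr_zero {G : GeoConsts} {P : SplitConsts} {Q : EngConsts} {R : RenConsts}
    {β U μ : ℝ} {Kd : TrigPolyC4v} {n : ℕ} (hG : R.Gfr 0 = 0) (hh : HistP klPredsV17F2 L M G P Q R β U μ Kd n) {m : ℕ} (hm : m ≤ n) :
    klLocalPart L M β U μ (klFlowFrameU L M β U μ m) m = klLocalPart L M β U μ 0 m :=
  klLocalPart_eq_zeroFrame_of_evalM L M β U μ (evalM_klFlowFrameU_eq_zero_of_histP_gfr_zero hG hh m hm) m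

/-- On the degenerate class the flow action at scale `m ≤ n` IS the zero-frame action. -/
theorem klFlowAction_eq_zeroFrame_of_histP_gfr_zero {G : GeoConsts} {P : SplitConsts} {Q : EngConsts} {R : RenConsts}
    {β U μ : ℝ} {Kd : TrigPolyC4v} {n : ℕ} (hG : R.Gfr 0 = 0) (hh : HistP klPredsV17F2 L M G P Q R β U μ Kd n) {m : ℕ} (hm : m ≤ n) :
    klEffectiveAction L M β U μ (klFlowFrameU L M β U μ m) klE0 m = klEffectiveAction L M β U μ 0 klE0 m :=
  klEffectiveAction_eq_zeroFrame_of_evalM L M β U μ (evalM_klFlowFrameU_eq_zero_of_histP_gfr_zero hG hh m hm) klE0 m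

/-- On the degenerate class the field strength at the flow frame IS the zero-frame field strength (`m ≤ n`). -/
theorem klFieldStrength_klFlowFrameU_eq_zeroFrame_of_histP_gfr_zero {G : GeoConsts} {P : SplitConsts} {Q : EngConsts} {R : RenConsts}
    {β U μ : ℝ} {Kd : TrigPolyC4v} {n : ℕ} (hG : R.Gfr 0 = 0) (hh : HistP klPredsV17F2 L M G P Q R β U μ Kd n) {m : ℕ} (hm : m ≤ n) :
    klFieldStrength L M β U μ (klFlowFrameU L M β U μ m) m = klFieldStrength L M β U μ 0 m :=
  klFieldStrength_eq_zeroFrame_of_evalM L M β U μ (evalM_klFlowFrameU_eq_zero_of_histP_gfr_zero hG hh m hm) m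

/-- On the degenerate class an `R`-admissible flow frame carries the zero-frame reading (the `FrameOK R U N μ (K_n)` binder alone). -/
theorem klLocalPart_klFlowFrameU_eq_zeroFrame_of_frameOK_gfr_zero {R : RenConsts} {β U μ : ℝ} {N n : ℕ} (hG : R.Gfr 0 = 0)
    (h : FrameOK R U N μ (klFlowFrameU L M β U μ n)) :
    klLocalPart L M β U μ (klFlowFrameU L M β U μ n) n = klLocalPart L M β U μ 0 n :=
  klLocalPart_eq_zeroFrame_of_evalM L M β U μ (evalM_klFlowFrameU_eq_zero_of_frameOK_gfr_zero hG h) n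

end Model

end Summit.HubbardSuperconductivity.HubbardSuperconductivity.Theorems.KLRegimeSplit

end
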